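import Mathlib
import Literature.Barriers.ValiantsHypothesis.AlgebraicNaturalProofs
import Summits.ValiantsHypothesis.ValiantsHypothesis.Theorems.BarrierLeverSuccinctHittingSetsForVPStubFewLinearForms
import HarnessLib

/-!
# Crux `BarrierLever.SuccinctHittingSetsForVP` (stmt-ValiantsHypothesis-14610), line `registered` —
`ΣΠΣ(2)` DISTINGUISHERS DO NOT ANNIHILATE THE TWO-SEED SEPARABLE GENERATOR
(registered stub `stub_sps2NotAnnihilated`, CONDITIONAL on stub SPS-A verbatim)

**What is proved (structure of the open heart; it does NOT close the item).**
In FSV's framework over `ℂ` (coefficient variables indexed by `degLEMonomials n`), consider the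
two-seed separable generator `Γ₂ : c_μ ↦ y₀ s₀^μ + y₁ s₁^μ` with values in the UFD
`A = ℂ[y_r, s_{r,i} : r < 2, i < n] = MvPolynomial (Fin 2 ⊕ (Fin 2 × Fin n)) ℂ`, and a `ΣΠΣ(2)`
distinguisher `D = a ∏_i ℓ_i + b ∏_j ℓ'_j` whose factors `ℓ_i, ℓ'_j` are non-constant affine forms
(`totalDegree = 1`) of the coefficient variables. ASSUMING (stub SPS-A, taken verbatim as a
hypothesis) that `Γ₂` maps every non-constant affine form to an irreducible element of `A`, we
prove `D ≠ 0 → D ∘ Γ₂ ≠ 0`: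

* `Sps2NotAnnihilated.eq_C_add_sum_of_totalDegree_le_one` : a polynomial of total degree `≤ 1` is
  the affine form `C (coeff_0 E) + Σ_μ coeff_{x_μ} E • X μ`;
* `Sps2NotAnnihilated.eq_zero_of_aeval_twoSeed_eq_zero` : `Γ₂` is injective on affine forms (the
  constant term is read off at `y = 0`; at `y = (1, 0)` one gets the polynomial `Σ_μ coeff_{x_μ} E x^μ`
  of `ℂ[x_1, …, x_n]`, whose coefficients are the `coeff_{x_μ} E`);
* `Sps2NotAnnihilated.eq_C_mul_of_associated` : for a substitution `Γ` injective on affine forms,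
  affine forms with associated images are proportional (units of `MvPolynomial τ ℂ` are the nonzero
  constants, `MvPolynomial.isUnit_iff_eq_C_of_isReduced`);
* `Sps2NotAnnihilated.prod_eq_C_mul_prod` : if moreover `Γ` maps non-constant affine forms to
  irreducibles, then `Associated (∏ Γ(ℓ_i)) (∏ Γ(ℓ'_j))` forces `∏ ℓ_i = κ ∏ ℓ'_j` for a constant
  `κ` (induction on the number of factors: `Γ(ℓ_0)` is prime, divides some `Γ(ℓ'_{j₀})`, hence is
  associated with it, so `ℓ_0 = u ℓ'_{j₀}`; cancel and recurse — `Associated.of_mul_left`);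
* `Sps2NotAnnihilated.aeval_ne_zero` : hence `a ∏ Γ(ℓ_i) + b ∏ Γ(ℓ'_j) = 0` with `D ≠ 0` is
  impossible (`a = 0` or `b = 0` force `D = 0`; otherwise the products are associated, so
  `D = (a κ + b) ∏ ℓ'_j` and `D ∘ Γ = (a κ + b) ∏ Γ(ℓ'_j) = 0` forces `a κ + b = 0`, i.e. `D = 0`);
* `stub_sps2NotAnnihilated` (registered stub) : the specialisation to `Γ₂`.

Axioms: `propext`, `Classical.choice`, `Quot.sound`. References: [ForbesShpilkaVolk2018] Question 6
(framework); the argument is the folklore `k = 2` case of identity testing for `ΣΠΣ(k)` circuits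
(unique factorisation, no rank bound needed).
-/

-- layout Summits/ValiantsHypothesis/ValiantsHypothesis forces the duplicated namespace component
set_option linter.dupNamespace false

namespace Summit.ValiantsHypothesis.ValiantsHypothesis.Theorems.BarrierLever.SuccinctHittingSetsForVP

open Literature.Barriers.ValiantsHypothesis Literature.Computability.AlgebraicComplexity MvPolynomial

namespace Sps2NotAnnihilated

variable {ι τ : Type*}

/-- **Affine expansion (polynomial identity).** A polynomial of total degree `≤ 1` over `ℂ` in
finitely many variables is `C (coeff_0 E) + Σ_μ coeff_{x_μ} E • X μ`. [folklore] -/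
theorem eq_C_add_sum_of_totalDegree_le_one [Fintype ι] {E : MvPolynomial ι ℂ}
    (hE : E.totalDegree ≤ 1) :
    E = C (coeff 0 E) + ∑ μ, coeff (Finsupp.single μ 1) E • (X μ : MvPolynomial ι ℂ) := by
  refine MvPolynomial.funext fun c => ?_
  rw [FewLinearForms.eval_eq_of_totalDegree_le_one hE c, map_add, map_sum, eval_C]
  simp only [smul_eval, eval_X]

/-- **`Γ₂` is injective on affine forms.** If `E` has total degree `≤ 1` and
`E(Γ₂) = 0` for the two-seed separable generator `Γ₂ μ = Σ_{r<2} y_r ∏_i s_{r,i}^{μ_i}`, then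
`E = 0`: evaluating at `y = 0` kills the constant term, and evaluating at `y = (1, 0)`,
`s₀ = x` shows that the polynomial `Σ_μ coeff_{x_μ} E · x^μ ∈ ℂ[x_1, …, x_n]` vanishes identically,
so all `coeff_{x_μ} E` vanish (the exponents `μ` are distinct). [folklore] -/
theorem eq_zero_of_aeval_twoSeed_eq_zero (n : ℕ) (E : MvPolynomial (degLEMonomials n) ℂ)
    (hE : E.totalDegree ≤ 1)
    (h0 : MvPolynomial.aeval
        (fun μ : degLEMonomials n => ∑ r : Fin 2,
            (X (Sum.inl r) : MvPolynomial (Fin 2 ⊕ (Fin 2 × Fin n)) ℂ) *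
              ∏ i : Fin n, X (Sum.inr (r, i)) ^ (μ : Fin n →₀ ℕ) i) E = 0) :
    E = 0 := by
  classical
  haveI : Fintype (degLEMonomials n) := (Finsupp.finite_of_degree_le (σ := Fin n) n).fintype
  -- evaluation of `E(Γ₂) = 0` at a point `x`
  have hev : ∀ x : Fin 2 ⊕ (Fin 2 × Fin n) → ℂ,
      coeff 0 E + ∑ μ : degLEMonomials n, coeff (Finsupp.single μ 1) E *
        (x (Sum.inl 0) * ∏ i, x (Sum.inr (0, i)) ^ (μ : Fin n →₀ ℕ) i +
          x (Sum.inl 1) * ∏ i, x (Sum.inr (1, i)) ^ (μ : Fin n →₀ ℕ) i) = 0 := by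
    intro x
    have h := congr_arg (eval x) h0
    rw [LowDegreeEquations.eval_comp_aeval, map_zero,
      FewLinearForms.eval_eq_of_totalDegree_le_one hE] at h
    simpa [map_sum, map_mul, map_prod, map_pow, eval_X] using h
  -- the constant coefficient: `x = 0`
  have hc0 : coeff 0 E = 0 := by
    simpa using hev 0
  -- the polynomial `Q = Σ_μ coeff_{x_μ} E · x^μ` vanishes identically: `y = (1, 0)`, `s₀ = x`
  set Q : MvPolynomial (Fin n) ℂ :=
    ∑ μ : degLEMonomials n, monomial (μ : Fin n →₀ ℕ) (coeff (Finsupp.single μ 1) E) with hQ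
  have hQ0 : Q = 0 := by
    refine MvPolynomial.funext fun s => ?_
    have h := hev (Sum.elim ![1, 0] fun ri => s ri.2)
    rw [hc0, zero_add] at h
    simp only [Sum.elim_inl, Sum.elim_inr, Matrix.cons_val_zero, Matrix.cons_val_one,
      one_mul, zero_mul, add_zero] at h
    rw [map_zero, hQ, map_sum, ← h]
    refine Finset.sum_congr rfl fun μ _ => ?_
    rw [eval_monomial, Finsupp.prod_fintype _ _ fun i => pow_zero _]
  -- hence all the coefficients `coeff_{x_μ} E` vanish
  have hc1 : ∀ ν : degLEMonomials n, coeff (Finsupp.single ν 1) E = 0 := by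
    intro ν
    have h := congr_arg (coeff (ν : Fin n →₀ ℕ)) hQ0
    rw [hQ, coeff_sum, coeff_zero] at h
    simp only [coeff_monomial] at h
    rw [Finset.sum_eq_single ν (fun μ _ hμν => if_neg fun h' => hμν (Subtype.ext h'))
      (fun hν => absurd (Finset.mem_univ ν) hν)] at h
    simpa using h
  rw [eq_C_add_sum_of_totalDegree_le_one hE, hc0]
  simp [hc1]

/-- **Associated images of affine forms are proportional.** If the substitution `Γ` is injective on
polynomials of total degree `≤ 1` and `Γ(ℓ₁)`, `Γ(ℓ₂)` are associated in `MvPolynomial τ ℂ` (whose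
units are the nonzero constants), then `ℓ₁ = u ℓ₂` for a constant `u`. [folklore] -/
theorem eq_C_mul_of_associated (Γ : ι → MvPolynomial τ ℂ)
    (hinj : ∀ E : MvPolynomial ι ℂ, E.totalDegree ≤ 1 → aeval Γ E = 0 → E = 0)
    {ℓ₁ ℓ₂ : MvPolynomial ι ℂ} (h₁ : ℓ₁.totalDegree ≤ 1) (h₂ : ℓ₂.totalDegree ≤ 1)
    (h : Associated (aeval Γ ℓ₁) (aeval Γ ℓ₂)) : ∃ u : ℂ, ℓ₁ = C u * ℓ₂ := by
  obtain ⟨w, hw⟩ := h.symm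
  obtain ⟨u, -, hu⟩ := MvPolynomial.isUnit_iff_eq_C_of_isReduced.1 w.isUnit
  refine ⟨u, sub_eq_zero.mp (hinj _ ?_ ?_)⟩
  · refine (totalDegree_sub _ _).trans (max_le h₁ ?_)
    exact (totalDegree_mul _ _).trans (by rw [totalDegree_C, zero_add]; exact h₂)
  · rw [map_sub, map_mul, algHom_C, algebraMap_eq, ← hw, hu, sub_eq_zero, mul_comm]

/-- **Unique factorisation.** If `Γ` is injective on affine forms and maps non-constant affine forms
to irreducibles of the UFD `MvPolynomial τ ℂ`, and the products `∏_i Γ(ℓ_i)`, `∏_j Γ(ℓ'_j)` of images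
of non-constant affine forms are associated, then `∏_i ℓ_i = κ ∏_j ℓ'_j` for a constant `κ`:
`Γ(ℓ_0)` is prime, divides some `Γ(ℓ'_{j₀})`, hence is associated with it, so `ℓ_0 = u ℓ'_{j₀}`;
cancel this factor and recurse. [folklore] -/
theorem prod_eq_C_mul_prod (Γ : ι → MvPolynomial τ ℂ)
    (hinj : ∀ E : MvPolynomial ι ℂ, E.totalDegree ≤ 1 → aeval Γ E = 0 → E = 0)
    (hirr : ∀ ℓ : MvPolynomial ι ℂ, ℓ.totalDegree = 1 → Irreducible (aeval Γ ℓ)) :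
    ∀ (p q : ℕ) (ℓ : Fin p → MvPolynomial ι ℂ) (ℓ' : Fin q → MvPolynomial ι ℂ),
      (∀ i, (ℓ i).totalDegree = 1) → (∀ j, (ℓ' j).totalDegree = 1) →
      Associated (∏ i, aeval Γ (ℓ i)) (∏ j, aeval Γ (ℓ' j)) →
      ∃ κ : ℂ, ∏ i, ℓ i = C κ * ∏ j, ℓ' j := by
  intro p
  induction p with
  | zero =>
    intro q ℓ ℓ' hℓ hℓ' hass
    cases q with
    | zero => exact ⟨1, by simp⟩
    | succ q =>
      exfalso
      have h1 := hass.symm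
      rw [Fin.prod_univ_zero, associated_one_iff_isUnit, Fin.prod_univ_succ, IsUnit.mul_iff] at h1
      exact (hirr _ (hℓ' 0)).not_isUnit h1.1
  | succ p ih =>
    intro q ℓ ℓ' hℓ hℓ' hass
    have hprime : Prime (aeval Γ (ℓ 0)) :=
      UniqueFactorizationMonoid.irreducible_iff_prime.mp (hirr _ (hℓ 0))
    have hdvd : aeval Γ (ℓ 0) ∣ ∏ j, aeval Γ (ℓ' j) :=
      hass.dvd_iff_dvd_right.mp (by rw [Fin.prod_univ_succ]; exact dvd_mul_right _ _)
    obtain ⟨j₀, -, hj₀⟩ := hprime.exists_mem_finset_dvd hdvd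
    have hass₀ : Associated (aeval Γ (ℓ 0)) (aeval Γ (ℓ' j₀)) :=
      (hirr _ (hℓ 0)).associated_of_dvd (hirr _ (hℓ' j₀)) hj₀
    obtain ⟨u, hu⟩ := eq_C_mul_of_associated Γ hinj (hℓ 0).le (hℓ' j₀).le hass₀
    cases q with
    | zero => exact j₀.elim0
    | succ q =>
      -- cancel the matched irreducible factor and recurse
      have hrest : Associated (∏ i : Fin p, aeval Γ (ℓ i.succ))
          (∏ j : Fin q, aeval Γ (ℓ' (j₀.succAbove j))) := by
        refine Associated.of_mul_left ?_ hass₀ hprime.ne_zero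
        rw [← Fin.prod_univ_succ (fun i => aeval Γ (ℓ i)),
          ← Fin.prod_univ_succAbove (fun j => aeval Γ (ℓ' j)) j₀]
        exact hass
      obtain ⟨κ, hκ⟩ := ih q (fun i => ℓ i.succ) (fun j => ℓ' (j₀.succAbove j)) (fun i => hℓ _)
        (fun j => hℓ' _) hrest
      refine ⟨u * κ, ?_⟩
      rw [Fin.prod_univ_succ, Fin.prod_univ_succAbove ℓ' j₀, hκ, hu, map_mul]
      ring

/-- **`ΣΠΣ(2)` does not annihilate a good substitution.** If `Γ` is injective on affine forms and
maps non-constant affine forms to irreducibles, then for `D = a ∏_i ℓ_i + b ∏_j ℓ'_j ≠ 0`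
(non-constant affine forms `ℓ_i, ℓ'_j`) we have `D(Γ) ≠ 0`: if `a = 0` or `b = 0` this is because
products of irreducibles are nonzero; otherwise `D(Γ) = 0` makes the two products of irreducibles
associated, so `∏ ℓ_i = κ ∏ ℓ'_j` (`prod_eq_C_mul_prod`), `D = (a κ + b) ∏ ℓ'_j`, and
`D(Γ) = (a κ + b) ∏ Γ(ℓ'_j) = 0` forces `a κ + b = 0`, i.e. `D = 0`. [folklore] -/
theorem aeval_ne_zero (Γ : ι → MvPolynomial τ ℂ)
    (hinj : ∀ E : MvPolynomial ι ℂ, E.totalDegree ≤ 1 → aeval Γ E = 0 → E = 0)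
    (hirr : ∀ ℓ : MvPolynomial ι ℂ, ℓ.totalDegree = 1 → Irreducible (aeval Γ ℓ))
    {p q : ℕ} (a b : ℂ) (ℓ : Fin p → MvPolynomial ι ℂ) (ℓ' : Fin q → MvPolynomial ι ℂ)
    (hℓ : ∀ i, (ℓ i).totalDegree = 1) (hℓ' : ∀ j, (ℓ' j).totalDegree = 1)
    (hD : C a * ∏ i, ℓ i + C b * ∏ j, ℓ' j ≠ 0) :
    aeval Γ (C a * ∏ i, ℓ i + C b * ∏ j, ℓ' j) ≠ 0 := by
  intro h0
  have hP₁ : (∏ i, aeval Γ (ℓ i)) ≠ 0 :=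
    Finset.prod_ne_zero_iff.mpr fun i _ => (hirr _ (hℓ i)).ne_zero
  have hP₂ : (∏ j, aeval Γ (ℓ' j)) ≠ 0 :=
    Finset.prod_ne_zero_iff.mpr fun j _ => (hirr _ (hℓ' j)).ne_zero
  have h0' : C a * ∏ i, aeval Γ (ℓ i) + C b * ∏ j, aeval Γ (ℓ' j) = 0 := by
    simpa only [map_add, map_mul, map_prod, algHom_C, algebraMap_eq] using h0
  by_cases ha : a = 0
  · subst ha
    rw [C_0, zero_mul, zero_add] at h0'
    have hb : b = 0 := C_eq_zero.mp ((mul_eq_zero.mp h0').resolve_right hP₂)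
    subst hb
    exact hD (by simp)
  by_cases hb : b = 0
  · subst hb
    rw [C_0, zero_mul, add_zero] at h0'
    exact ha (C_eq_zero.mp ((mul_eq_zero.mp h0').resolve_right hP₁))
  -- `a ≠ 0 ≠ b`: the two products of irreducibles are associated
  have hbb : (C b⁻¹ : MvPolynomial τ ℂ) * C b = 1 := by
    rw [← map_mul, inv_mul_cancel₀ hb, map_one]
  have hunit : IsUnit (-(C a * C b⁻¹) : MvPolynomial τ ℂ) :=
    (((isUnit_iff_ne_zero.mpr ha).map C).mul
      ((isUnit_iff_ne_zero.mpr (inv_ne_zero hb)).map C)).neg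
  have hass : Associated (∏ i, aeval Γ (ℓ i)) (∏ j, aeval Γ (ℓ' j)) := by
    refine ⟨hunit.unit, ?_⟩
    rw [IsUnit.unit_spec]
    linear_combination (-(C b⁻¹ : MvPolynomial τ ℂ)) * h0' + (∏ j, aeval Γ (ℓ' j)) * hbb
  obtain ⟨κ, hκ⟩ := prod_eq_C_mul_prod Γ hinj hirr p q ℓ ℓ' hℓ hℓ' hass
  -- so `D = (a κ + b) ∏ ℓ'_j` and `D(Γ) = (a κ + b) ∏ Γ(ℓ'_j) = 0` forces `a κ + b = 0`
  have hD' : C a * ∏ i, ℓ i + C b * ∏ j, ℓ' j = C (a * κ + b) * ∏ j, ℓ' j := by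
    rw [hκ, map_add, map_mul]
    ring
  have hzero : a * κ + b = 0 := by
    have h1 : C (a * κ + b) * ∏ j, aeval Γ (ℓ' j) = 0 := by
      have h2 := h0
      rw [hD', map_mul, map_prod, algHom_C, algebraMap_eq] at h2
      exact h2
    rcases mul_eq_zero.mp h1 with h | h
    · exact C_eq_zero.mp h
    · exact absurd h hP₂
  exact hD (by rw [hD', hzero, C_0, zero_mul])

end Sps2NotAnnihilated

/-- **Registered stub `stub_sps2NotAnnihilated`** (crux stmt-ValiantsHypothesis-14610, line
`registered`; STUB SPS-B, CONDITIONAL on STUB SPS-A verbatim): if the two-seed separable generator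
`Γ₂ : c_μ ↦ y₀ s₀^μ + y₁ s₁^μ` maps every non-constant affine form of the coefficient variables to
an irreducible element of `ℂ[y, s]` (hypothesis), then no nonzero `ΣΠΣ(2)` distinguisher
`D = a ∏_i ℓ_i + b ∏_j ℓ'_j` (non-constant affine forms `ℓ_i, ℓ'_j`) annihilates `Γ₂`: by unique
factorisation in the UFD `MvPolynomial _ ℂ`, `D(Γ₂) = 0` with `a, b ≠ 0` matches the irreducibles
`Γ₂(ℓ_i)` with the `Γ₂(ℓ'_j)` up to nonzero constants, and `Γ₂` is injective on affine forms, so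
`∏ ℓ_i = κ ∏ ℓ'_j`, `D = (a κ + b) ∏ ℓ'_j`, and `D(Γ₂) = 0` forces `a κ + b = 0`, i.e. `D = 0`
(the `k = 2` case of identity testing for `ΣΠΣ(k)` circuits).
[cite: ForbesShpilkaVolk2018, Question 6] -/
theorem stub_sps2NotAnnihilated :
    (∀ (n : ℕ) (ℓ : MvPolynomial (degLEMonomials n) ℂ), ℓ.totalDegree = 1 →
      Irreducible (MvPolynomial.aeval
        (fun μ : degLEMonomials n => ∑ r : Fin 2,
            (X (Sum.inl r) : MvPolynomial (Fin 2 ⊕ (Fin 2 × Fin n)) ℂ) *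
              ∏ i : Fin n, X (Sum.inr (r, i)) ^ (μ : Fin n →₀ ℕ) i) ℓ)) →
    ∀ (n p q : ℕ) (a b : ℂ) (ℓ : Fin p → MvPolynomial (degLEMonomials n) ℂ)
      (ℓ' : Fin q → MvPolynomial (degLEMonomials n) ℂ),
      (∀ i, (ℓ i).totalDegree = 1) → (∀ j, (ℓ' j).totalDegree = 1) →
      C a * ∏ i, ℓ i + C b * ∏ j, ℓ' j ≠ 0 →
      MvPolynomial.aeval
        (fun μ : degLEMonomials n => ∑ r : Fin 2,
            (X (Sum.inl r) : MvPolynomial (Fin 2 ⊕ (Fin 2 × Fin n)) ℂ) *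
              ∏ i : Fin n, X (Sum.inr (r, i)) ^ (μ : Fin n →₀ ℕ) i)
        (C a * ∏ i, ℓ i + C b * ∏ j, ℓ' j) ≠ 0 := by
  intro hA n p q a b ℓ ℓ' hℓ hℓ' hD
  exact Sps2NotAnnihilated.aeval_ne_zero _
    (fun E hE h0 => Sps2NotAnnihilated.eq_zero_of_aeval_twoSeed_eq_zero n E hE h0) (hA n)
    a b ℓ ℓ' hℓ hℓ' hD

end Summit.ValiantsHypothesis.ValiantsHypothesis.Theorems.BarrierLever.SuccinctHittingSetsForVP
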